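import Mathlib
import HarnessLib

/-!
# Route `PoloidalWindowDoor`, crux `PoloidalWindowRigidity` (stmt-19708) / item `LrcModEntire` (stmt-20428), ideator line `thread_axis`
# (ns-idea-8) — stub S7′-M `stub_morseLevelPackage`, helper III: THE PLANAR LEVEL MAP `y ↦ (g y − c, y₂ − h)` AND THE SIGN REDUCTION

Seat ns-poloidal-K2-p2 g10 (LEAD-lineage on 19708; file `--supports`).  Book-keeping for the `ℝ²`-valued level map of the Morse
package:

* `vec2_eq_zero_iff`, `contDiff_vec2` — the pair `![a, b] : Fin 2 → ℝ`;
* `pi2_apply`, `hasFDerivAt_planar` — the planar level map `P y = (g y − c, y₂ − h)` has derivative `w ↦ (dg(y)w, w₂)`;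
* `surjective_planar` — that derivative is onto `ℝ²` as soon as `∂₀g(y) ≠ 0 ∨ ∂₁g(y) ≠ 0`;
* `package_of_neg` — the S7′-M package for `−g` at a point `p` yields the package for `g` at `p` (flip the sign of the first
  component of `H`), so the stub reduces to the case of a global MAXIMUM `g 0 > 0`.

WHAT THIS IS NOT: not a claim about Navier–Stokes; linear algebra in `ℝ² / ℝ³` (bears_on LADDER-NS N0 via crux 19708 / item 20428, thread_axis S7′-M). [folklore]
-/

noncomputable section

-- the summit and its single sub-problem share the name (CONVENTIONS §1), as in every Theorems file
set_option linter.dupNamespace false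

namespace Summit.NavierStokesRegularity.NavierStokesRegularity.Theorems.PoloidalWindowDoorLrcModEntireMorseLevelCutoff

open Set Function Filter Topology Metric

variable {g : EuclideanSpace ℝ (Fin 3) → ℝ}

/-! ### Pairs -/

/-- `![a, b] = 0 ↔ a = 0 ∧ b = 0`. [folklore] -/
theorem vec2_eq_zero_iff (a b : ℝ) : (![a, b] : Fin 2 → ℝ) = 0 ↔ a = 0 ∧ b = 0 := by
  constructor
  · intro h
    exact ⟨by simpa using congr_fun h 0, by simpa using congr_fun h 1⟩
  · rintro ⟨ha, hb⟩
    funext i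
    fin_cases i <;> simp [ha, hb]

/-- A pair of `Cⁿ` functions is `Cⁿ` as a map into `Fin 2 → ℝ`. [folklore] -/
theorem contDiff_vec2 {n : WithTop ℕ∞} {a b : EuclideanSpace ℝ (Fin 3) → ℝ} (ha : ContDiff ℝ n a) (hb : ContDiff ℝ n b) :
    ContDiff ℝ n fun y => (![a y, b y] : Fin 2 → ℝ) := by
  rw [contDiff_pi]
  intro i
  fin_cases i
  · simpa using ha
  · simpa using hb

/-- The coordinate `y ↦ y₂` is smooth. [folklore] -/
theorem contDiff_apply_two {n : WithTop ℕ∞} : ContDiff ℝ n fun y : EuclideanSpace ℝ (Fin 3) => y 2 :=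
  (EuclideanSpace.proj (2 : Fin 3) : EuclideanSpace ℝ (Fin 3) →L[ℝ] ℝ).contDiff

/-! ### The planar level map -/

/-- The derivative `w ↦ (dg(y)w, w₂)` as a continuous linear map, evaluated. [folklore] -/
theorem pi2_apply (y w : EuclideanSpace ℝ (Fin 3)) :
    (ContinuousLinearMap.pi ![fderiv ℝ g y, (EuclideanSpace.proj (2 : Fin 3) : EuclideanSpace ℝ (Fin 3) →L[ℝ] ℝ)]) w =
      ![fderiv ℝ g y w, w 2] := by
  funext i
  fin_cases i <;> simp

/-- `![a, b] = ![a', b']` from `a = a'`, `b = b'`. [folklore] -/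
theorem vec2_ext {a a' b b' : ℝ} (ha : a = a') (hb : b = b') : (![a, b] : Fin 2 → ℝ) = ![a', b'] := by
  rw [ha, hb]

/-- **The planar level map is differentiable** with derivative `w ↦ (dg(y)w, w₂)`. [folklore] -/
theorem hasFDerivAt_planar {y : EuclideanSpace ℝ (Fin 3)} (hg : DifferentiableAt ℝ g y) (c h : ℝ) :
    HasFDerivAt (fun y : EuclideanSpace ℝ (Fin 3) => (![g y - c, y 2 - h] : Fin 2 → ℝ))
      (ContinuousLinearMap.pi ![fderiv ℝ g y, (EuclideanSpace.proj (2 : Fin 3) : EuclideanSpace ℝ (Fin 3) →L[ℝ] ℝ)]) y := by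
  set Φ' := ContinuousLinearMap.pi ![fderiv ℝ g y, (EuclideanSpace.proj (2 : Fin 3) : EuclideanSpace ℝ (Fin 3) →L[ℝ] ℝ)]
    with hΦ'
  rw [hasFDerivAt_pi']
  intro i
  fin_cases i
  · have h1 : HasFDerivAt (fun y => g y - c) (fderiv ℝ g y) y := hg.hasFDerivAt.sub_const c
    have e1 : (fun x : EuclideanSpace ℝ (Fin 3) => (![g x - c, x 2 - h] : Fin 2 → ℝ) ((⟨0, by norm_num⟩ : Fin 2))) =
        fun x => g x - c := by
      funext x; rfl
    have e2 : (ContinuousLinearMap.proj ((⟨0, by norm_num⟩ : Fin 2))).comp Φ' = fderiv ℝ g y := by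
      ext w; simp [hΦ']
    rw [e1, e2]
    exact h1
  · have h2 : HasFDerivAt (fun y : EuclideanSpace ℝ (Fin 3) => y 2 - h)
        (EuclideanSpace.proj (2 : Fin 3) : EuclideanSpace ℝ (Fin 3) →L[ℝ] ℝ) y :=
      ((EuclideanSpace.proj (2 : Fin 3) : EuclideanSpace ℝ (Fin 3) →L[ℝ] ℝ).hasFDerivAt).sub_const h
    have e1 : (fun x : EuclideanSpace ℝ (Fin 3) => (![g x - c, x 2 - h] : Fin 2 → ℝ) ((⟨1, by norm_num⟩ : Fin 2))) =
        fun x => x 2 - h := by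
      funext x; rfl
    have e2 : (ContinuousLinearMap.proj ((⟨1, by norm_num⟩ : Fin 2))).comp Φ' =
        (EuclideanSpace.proj (2 : Fin 3) : EuclideanSpace ℝ (Fin 3) →L[ℝ] ℝ) := by
      ext w; simp [hΦ']
    rw [e1, e2]
    exact h2

/-- **If `H` agrees with the planar level map near `y`, then `dH(y) w = (dg(y)w, w₂)`.** [folklore] -/
theorem fderiv_eq_planar_of_eventuallyEq {H : EuclideanSpace ℝ (Fin 3) → (Fin 2 → ℝ)} {y : EuclideanSpace ℝ (Fin 3)} {c h : ℝ}
    (hg : DifferentiableAt ℝ g y) (hH : H =ᶠ[𝓝 y] fun y => (![g y - c, y 2 - h] : Fin 2 → ℝ)) (w : EuclideanSpace ℝ (Fin 3)) :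
    fderiv ℝ H y w = ![fderiv ℝ g y w, w 2] := by
  rw [hH.fderiv_eq, (hasFDerivAt_planar hg c h).fderiv, pi2_apply]

/-- **The planar derivative is onto `ℝ²`** when the horizontal gradient is non-zero: given `(a, b)` solve `dg(y)w = a`, `w₂ = b` with
`w = s•eᵢ + b•e₂`, `i` a horizontal direction with `∂ᵢg(y) ≠ 0`. [folklore] -/
theorem surjective_planar {y : EuclideanSpace ℝ (Fin 3)} {D : EuclideanSpace ℝ (Fin 3) →L[ℝ] (Fin 2 → ℝ)}
    (hD : ∀ w, D w = ![fderiv ℝ g y w, w 2])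
    (hreg : fderiv ℝ g y (EuclideanSpace.single 0 1) ≠ 0 ∨ fderiv ℝ g y (EuclideanSpace.single 1 1) ≠ 0) :
    Function.Surjective D := by
  intro v
  set a : ℝ := v 0
  set b : ℝ := v 1
  set d₂ : ℝ := fderiv ℝ g y (EuclideanSpace.single 2 1)
  have hv : v = ![a, b] := by funext i; fin_cases i <;> rfl
  rcases hreg with hd | hd
  · set d : ℝ := fderiv ℝ g y (EuclideanSpace.single 0 1)
    refine ⟨((a - b * d₂) / d) • EuclideanSpace.single 0 1 + b • EuclideanSpace.single 2 1, ?_⟩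
    rw [hD, hv]
    funext i
    fin_cases i
    · simp only [map_add, map_smul, smul_eq_mul]
      simp
      field_simp
      ring
    · simp
  · set d : ℝ := fderiv ℝ g y (EuclideanSpace.single 1 1)
    refine ⟨((a - b * d₂) / d) • EuclideanSpace.single 1 1 + b • EuclideanSpace.single 2 1, ?_⟩
    rw [hD, hv]
    funext i
    fin_cases i
    · simp only [map_add, map_smul, smul_eq_mul]
      simp
      field_simp
      ring
    · simp

/-! ### The sign reduction -/

/-- Derivative of `x ↦ dg(x)e` for the negated function. [folklore] -/
theorem fderiv_fderiv_neg_apply (g : EuclideanSpace ℝ (Fin 3) → ℝ) (e : EuclideanSpace ℝ (Fin 3)) :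
    fderiv ℝ (fun x => fderiv ℝ (fun z => -g z) x e) 0 e = -fderiv ℝ (fun x => fderiv ℝ g x e) 0 e := by
  have h1 : (fun x => fderiv ℝ (fun z => -g z) x e) = fun x => -fderiv ℝ g x e := by
    funext x
    rw [show (fun z => -g z) = -g from rfl, fderiv_neg]
    rfl
  rw [h1, show (fun x => -fderiv ℝ g x e) = -(fun x => fderiv ℝ g x e) from rfl, fderiv_neg]
  rfl

/-- **Sign reduction.**  The S7′-M package for `−g` at the point `p` (level map `H'`, cut-off `χ`, radius `R`, covering curve `σ`)
yields the package for `g` at `p`: flip the sign of the first component of `H'`. [folklore] -/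
theorem package_of_neg (g : EuclideanSpace ℝ (Fin 3) → ℝ) (p : EuclideanSpace ℝ (Fin 3))
    (H' : EuclideanSpace ℝ (Fin 3) → (Fin 2 → ℝ)) (χ : EuclideanSpace ℝ (Fin 3) → ℝ) (R : ℝ)
    (h1 : ContDiff ℝ 1 H') (h2 : ContDiff ℝ 1 χ) (h3 : H' p = 0)
    (h4 : ∀ y, H' y = 0 → ‖y‖ ≤ R)
    (h5 : ∀ y, H' y = 0 → Function.Surjective (fderiv ℝ H' y))
    (h6 : ∀ y, H' y = 0 → χ y = 1)
    (h7 : ∀ y, χ y ≠ 0 → H' y = ![(fun z => -g z) y - (fun z => -g z) p, y 2 - p 2])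
    (h8 : ∀ y, χ y ≠ 0 → ∀ w, fderiv ℝ H' y w = ![fderiv ℝ (fun z => -g z) y w, w 2])
    (h9 : ∀ y, H' y = 0 → fderiv ℝ (fun z => -g z) y (EuclideanSpace.single 0 1) ≠ 0 ∨
      fderiv ℝ (fun z => -g z) y (EuclideanSpace.single 1 1) ≠ 0)
    (σ σ' : ℝ → EuclideanSpace ℝ (Fin 3)) (h10 : ∀ θ, HasDerivAt σ (σ' θ) θ) (h11 : ∀ θ, σ' θ 2 = 0)
    (h12 : ∀ θ, fderiv ℝ (fun z => -g z) (σ θ) (σ' θ) = 0) (h13 : ∀ θ, H' (σ θ) = 0) (h14 : ∀ y, H' y = 0 → ∃ θ, σ θ = y) :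
    ∃ (H : EuclideanSpace ℝ (Fin 3) → (Fin 2 → ℝ)) (χ : EuclideanSpace ℝ (Fin 3) → ℝ) (R : ℝ),
      ContDiff ℝ 1 H ∧ ContDiff ℝ 1 χ ∧ H p = 0 ∧
      (∀ y, H y = 0 → ‖y‖ ≤ R) ∧
      (∀ y, H y = 0 → Function.Surjective (fderiv ℝ H y)) ∧
      (∀ y, H y = 0 → χ y = 1) ∧
      (∀ y, χ y ≠ 0 → H y = ![g y - g p, y 2 - p 2]) ∧
      (∀ y, χ y ≠ 0 → ∀ w, fderiv ℝ H y w = ![fderiv ℝ g y w, w 2]) ∧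
      (∀ y, H y = 0 → fderiv ℝ g y (EuclideanSpace.single 0 1) ≠ 0 ∨
        fderiv ℝ g y (EuclideanSpace.single 1 1) ≠ 0) ∧
      ∃ σ σ' : ℝ → EuclideanSpace ℝ (Fin 3),
        (∀ θ, HasDerivAt σ (σ' θ) θ) ∧ (∀ θ, σ' θ 2 = 0) ∧ (∀ θ, fderiv ℝ g (σ θ) (σ' θ) = 0) ∧
        (∀ θ, H (σ θ) = 0) ∧ (∀ y, H y = 0 → ∃ θ, σ θ = y) := by
  have hneg : ∀ y w, fderiv ℝ (fun z => -g z) y w = -fderiv ℝ g y w := fun y w => by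
    rw [show (fun z => -g z) = -g from rfl, fderiv_neg]; rfl
  -- the sign flip on the first component, a continuous linear automorphism of `ℝ²`
  set Lf : (Fin 2 → ℝ) →L[ℝ] (Fin 2 → ℝ) :=
    ContinuousLinearMap.pi ![-(ContinuousLinearMap.proj (R := ℝ) (φ := fun _ : Fin 2 => ℝ) 0),
      ContinuousLinearMap.proj (R := ℝ) (φ := fun _ : Fin 2 => ℝ) 1] with hLf
  have hLf_apply : ∀ v : Fin 2 → ℝ, Lf v = ![-v 0, v 1] := fun v => by
    funext i; fin_cases i <;> simp [hLf]
  have hLf_zero_iff : ∀ v : Fin 2 → ℝ, Lf v = 0 ↔ v = 0 := fun v => by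
    rw [hLf_apply]
    constructor
    · intro h
      have h0 : -v 0 = 0 := by simpa using congr_fun h 0
      have h1' : v 1 = 0 := by simpa using congr_fun h 1
      funext i; fin_cases i
      · simpa using h0
      · simpa using h1'
    · intro h; rw [h]; funext i; fin_cases i <;> simp
  set H : EuclideanSpace ℝ (Fin 3) → (Fin 2 → ℝ) := fun y => Lf (H' y) with hH
  have hHzero : ∀ y, H y = 0 ↔ H' y = 0 := fun y => hLf_zero_iff (H' y)
  have hHd : ContDiff ℝ 1 H := Lf.contDiff.comp h1
  have hHfd : ∀ y, fderiv ℝ H y = Lf.comp (fderiv ℝ H' y) := fun y =>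
    (Lf.hasFDerivAt.comp y ((h1.differentiable one_ne_zero) y).hasFDerivAt).fderiv
  refine ⟨H, χ, R, hHd, h2, (hHzero p).2 h3, fun y hy => h4 y ((hHzero y).1 hy), fun y hy => ?_,
    fun y hy => h6 y ((hHzero y).1 hy), fun y hy => ?_, fun y hy w => ?_, fun y hy => ?_,
    σ, σ', h10, h11, fun θ => ?_, fun θ => (hHzero _).2 (h13 θ), fun y hy => h14 y ((hHzero y).1 hy)⟩
  · -- surjectivity survives the automorphism
    rw [hHfd]
    intro v
    obtain ⟨w, hw⟩ := h5 y ((hHzero y).1 hy) (![-v 0, v 1])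
    refine ⟨w, ?_⟩
    rw [ContinuousLinearMap.comp_apply, hw, hLf_apply]
    simp only [Matrix.cons_val_zero, Matrix.cons_val_one, neg_neg]
    funext i; fin_cases i <;> rfl
  · -- the values where `χ ≠ 0`
    show Lf (H' y) = _
    rw [h7 y hy, hLf_apply]
    simp only [Matrix.cons_val_zero, Matrix.cons_val_one]
    exact vec2_ext (by ring) rfl
  · -- the derivative where `χ ≠ 0`
    rw [hHfd, ContinuousLinearMap.comp_apply, h8 y hy w, hLf_apply, hneg]
    simp only [Matrix.cons_val_zero, Matrix.cons_val_one, neg_neg]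
  · -- the horizontal gradient
    have := h9 y ((hHzero y).1 hy)
    rwa [hneg, hneg, neg_ne_zero, neg_ne_zero] at this
  · have := h12 θ
    rwa [hneg, neg_eq_zero] at this

end Summit.NavierStokesRegularity.NavierStokesRegularity.Theorems.PoloidalWindowDoorLrcModEntireMorseLevelCutoff

end
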